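import Mathlib.Analysis.Complex.ExponentialBounds
import Mathlib.Analysis.SpecialFunctions.Pow.Real
import HarnessLib

/-!
# A stretched-exponential tail estimate for Kesten's density step

Topic `Literature/Probability/RandomPlanarGeometry` (lane «pcv-sawmu»; shared by the honeycomb bridge file
`HexSAWBrickWallBridgeKesten.lean` (R76) and the triangular polygon file (R82)). Source: N. Madras, G. Slade,
*The Self-Avoiding Walk* (1993), §7.3, proof of Theorem 7.3.2, (7.3.9)–(7.3.10) p. 246: the density of pattern-poor
walks is exponentially small, `≤ C 2^{−N/Q} μ^N`, and is compared with the class count through `μ^N ≤ c_N`. For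
BRIDGES, POLYGONS or half-space walks the comparison `μ^N ≤ A e^{a√N} · (class count)` carries a stretched exponential
(Hammersley–Welsh), which the exponential density absorbs: this file proves the elementary inequality
**`(1/2)^{⌊N/Q⌋} · e^{a√N} · N³ ≤ 16 · e^{(a+3)² Q}`** (`a ≥ 0`, `Q ≥ 1`) by `N³ ≤ 8 e^{3√N}`, the AM–GM step
`(a+3)√(Q(k+1)) ≤ (k+1)/4 + (a+3)² Q` and `e^{1/4} ≤ 2`.

## Contents (namespace `Literature.Probability.RandomPlanarGeometry.SAW`; all PROVED, axioms standard)

* `cube_le_exp_sqrt : N³ ≤ 8 e^{3√N}`;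
* **`half_pow_div_mul_exp_mul_cube_le : (1/2)^{⌊N/Q⌋} e^{a√N} N³ ≤ 16 e^{(a+3)² Q}`**.
-/

noncomputable section

namespace Literature.Probability.RandomPlanarGeometry.SAW

/-- `N³ ≤ 8 e^{3√N}` (from `t²/2 ≤ e^t`, `t = √N`) — tail arithmetic of the density step.
[cite: MadrasSlade1993, §7.3, proof of Theorem 7.3.2, (7.3.9)–(7.3.10)] -/
theorem cube_le_exp_sqrt (N : ℕ) : (N : ℝ) ^ 3 ≤ 8 * Real.exp (3 * Real.sqrt N) := by
  set t : ℝ := Real.sqrt N with ht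
  have ht0 : 0 ≤ t := Real.sqrt_nonneg _
  have htN : t ^ 2 = N := Real.sq_sqrt (Nat.cast_nonneg _)
  have h1 : t ^ 2 ≤ 2 * Real.exp t := by
    have := Real.quadratic_le_exp_of_nonneg ht0
    nlinarith [Real.exp_pos t]
  have h2 : (t ^ 2) ^ 3 ≤ (2 * Real.exp t) ^ 3 := pow_le_pow_left₀ (by positivity) h1 3
  rw [htN] at h2
  calc (N : ℝ) ^ 3 ≤ (2 * Real.exp t) ^ 3 := h2
    _ = 8 * Real.exp (3 * t) := by
        rw [mul_pow, ← Real.exp_nat_mul]; norm_num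

/-- **The stretched-exponential tail against the exponential density**:
`(1/2)^{⌊N/Q⌋} · e^{a√N} · N³ ≤ 16 · e^{(a+3)² Q}` for `a ≥ 0`, `Q ≥ 1` — the arithmetic by which the comparison
`μ^N ≤ A e^{a√N} · (count)` replaces `μ^N ≤ c_N` in the density step (7.3.9)–(7.3.10) for bridges, polygons and
half-space walks. [cite: MadrasSlade1993, §7.3, proof of Theorem 7.3.2, (7.3.9)–(7.3.10)] -/
theorem half_pow_div_mul_exp_mul_cube_le {Q : ℕ} (hQ : 0 < Q) {a : ℝ} (ha : 0 ≤ a) (N : ℕ) :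
    (1 / 2 : ℝ) ^ (N / Q) * Real.exp (a * Real.sqrt N) * (N : ℝ) ^ 3 ≤ 16 * Real.exp ((a + 3) ^ 2 * Q) := by
  set k := N / Q with hk
  have hQr : (0 : ℝ) < Q := by exact_mod_cast hQ
  have hNle : (N : ℝ) ≤ Q * ((k : ℝ) + 1) := by
    have : N ≤ Q * (k + 1) := (Nat.lt_mul_div_succ N hQ).le
    exact_mod_cast this
  -- `e^{a√N} N³ ≤ 8 e^{(a+3)√N} ≤ 8 e^{(a+3) √(Q(k+1))}`
  set s : ℝ := Real.sqrt ((Q : ℝ) * ((k : ℝ) + 1)) with hs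
  have hs0 : 0 ≤ s := Real.sqrt_nonneg _
  have hs2 : s ^ 2 = (Q : ℝ) * ((k : ℝ) + 1) := Real.sq_sqrt (by positivity)
  have hsqrt : Real.sqrt N ≤ s := Real.sqrt_le_sqrt hNle
  have ha3 : 0 ≤ a + 3 := by linarith
  have h1 : Real.exp (a * Real.sqrt N) * (N : ℝ) ^ 3 ≤ 8 * Real.exp ((a + 3) * s) := by
    calc Real.exp (a * Real.sqrt N) * (N : ℝ) ^ 3
        ≤ Real.exp (a * Real.sqrt N) * (8 * Real.exp (3 * Real.sqrt N)) :=
          mul_le_mul_of_nonneg_left (cube_le_exp_sqrt N) (Real.exp_nonneg _)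
      _ = 8 * Real.exp ((a + 3) * Real.sqrt N) := by
          rw [mul_left_comm, ← Real.exp_add]; ring_nf
      _ ≤ 8 * Real.exp ((a + 3) * s) := by gcongr
  -- AM–GM: `(a+3) s ≤ (k+1)/4 + (a+3)² Q`
  have h2 : (a + 3) * s ≤ ((k : ℝ) + 1) / 4 + (a + 3) ^ 2 * Q := by
    have e : ((k : ℝ) + 1) / 4 = s ^ 2 / (4 * Q) := by rw [hs2]; field_simp
    rw [e, ← sub_nonneg]
    have : s ^ 2 / (4 * Q) + (a + 3) ^ 2 * Q - (a + 3) * s = (s - 2 * (a + 3) * Q) ^ 2 / (4 * Q) := by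
      field_simp; ring
    rw [this]; positivity
  -- `(1/2)^k e^{(k+1)/4} ≤ 2`
  have h3 : (1 / 2 : ℝ) ^ k * Real.exp (((k : ℝ) + 1) / 4) ≤ 2 := by
    have he : Real.exp ((1 : ℝ) / 4) ≤ 2 := by
      have h3 := Real.exp_one_lt_three
      have h4 : Real.exp ((1 : ℝ) / 4) ^ 4 = Real.exp 1 := by rw [← Real.exp_nat_mul]; norm_num
      by_contra hlt
      push Not at hlt
      have : (2 : ℝ) ^ 4 < Real.exp ((1 : ℝ) / 4) ^ 4 := pow_lt_pow_left₀ hlt (by norm_num) (by norm_num)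
      rw [h4] at this
      linarith
    have hek : Real.exp (((k : ℝ) + 1) / 4) = Real.exp (1 / 4) * Real.exp (1 / 4) ^ k := by
      rw [← Real.exp_nat_mul, ← Real.exp_add]; ring_nf
    rw [hek, show (1 / 2 : ℝ) ^ k * (Real.exp (1 / 4) * Real.exp (1 / 4) ^ k) =
      Real.exp (1 / 4) * ((1 / 2 : ℝ) * Real.exp (1 / 4)) ^ k by rw [mul_pow]; ring]
    have hq : ((1 / 2 : ℝ) * Real.exp (1 / 4)) ^ k ≤ 1 := pow_le_one₀ (by positivity) (by linarith)
    nlinarith [Real.exp_pos ((1 : ℝ) / 4)]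
  have h4 : Real.exp ((a + 3) * s) ≤ Real.exp (((k : ℝ) + 1) / 4) * Real.exp ((a + 3) ^ 2 * Q) := by
    rw [← Real.exp_add]; exact Real.exp_le_exp.2 h2
  have hhalf : (0 : ℝ) ≤ (1 / 2 : ℝ) ^ k := by positivity
  calc (1 / 2 : ℝ) ^ k * Real.exp (a * Real.sqrt N) * (N : ℝ) ^ 3
      = (1 / 2 : ℝ) ^ k * (Real.exp (a * Real.sqrt N) * (N : ℝ) ^ 3) := by ring
    _ ≤ (1 / 2 : ℝ) ^ k * (8 * Real.exp ((a + 3) * s)) := mul_le_mul_of_nonneg_left h1 hhalf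
    _ ≤ (1 / 2 : ℝ) ^ k * (8 * (Real.exp (((k : ℝ) + 1) / 4) * Real.exp ((a + 3) ^ 2 * Q))) := by gcongr
    _ = 8 * ((1 / 2 : ℝ) ^ k * Real.exp (((k : ℝ) + 1) / 4)) * Real.exp ((a + 3) ^ 2 * Q) := by ring
    _ ≤ 8 * 2 * Real.exp ((a + 3) ^ 2 * Q) := by gcongr
    _ = 16 * Real.exp ((a + 3) ^ 2 * Q) := by norm_num

end Literature.Probability.RandomPlanarGeometry.SAW
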